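import Literature.AlgebraicGeometry.Frobenioids.FinSubextCat
import Literature.FieldTheory.Regular.SeparablyClosedIrreducible
import Mathlib.RingTheory.TensorProduct.Maps
import Mathlib.LinearAlgebra.Dimension.Constructions
import Mathlib.FieldTheory.Galois.Basic
import Mathlib.CategoryTheory.Functor.Basic
import HarnessLib

/-!
# Frobenioids I, Theorem 6.2 (i): the base functor `D₁ → D₂`, `L₁ ↦ L₁ · K₂`, induced by `K₁ ↪ K₂`

Mochizuki, *The geometry of Frobenioids I: the general theory*, Kyushu J. Math. **62** (2008) 293–400,
Theorem 6.2 (i), kurims text p. 110 l. 45 – p. 111 l. 5 and proof p. 111 l. 23–28: "by assumptions (b)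
[`K₁ ↪ K₂ ↪ K̃₂` factors through `K̃₁`], (c) [`K₁` is separably closed in `K₂`], it follows that any finite
extension `L₁ ⊆ K̃₁` of `K₁` determines a finite extension `L₂ := L₁ · K₂ ⊆ K̃₂` of `K₂` such that
`[L₂ : K₂] = [L₁ : K₁]`. Thus, `ψ` determines a functor `D₁ → D₂`." [cite: MochizukiFrdI2008, Thm. 6.2 (i) p.111]

This file CONSTRUCTS that functor on the cell's base categories `D_i = FinSubextCat K_i K̃_i`
(abc-iut-L1-t3/L6-t10: finite subextensions, `Hom(Spec L, Spec M) = Hom_K(M, L)`), for field data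
`K₁ → K₂`, `ι : K̃₁ → K̃₂` over `K₁ → K̃₂` (hypothesis (b)) with `K₁` separably closed in `K₂` (hypothesis (c))
and `K̃₁/K₁` separable (it is Galois in [FrdI] §6):
* `FinSubextCat.compositumObj` — `L₁ ↦ L₁ · K₂ := K₂(ι L₁) ⊆ K̃₂`, finite over `K₂` OF THE SAME DEGREE
  (`finrank_compositumObj`, from `Literature.FieldTheory.Regular.finrank_adjoin_eq_of_isSepClosedIn`);
* `FinSubextCat.compositumEquiv` — linear disjointness made explicit: the multiplication map
  `K₂ ⊗_{K₁} L₁ ⥲ L₁ · K₂` is an ISOMORPHISM of `K₂`-algebras (surjective onto the compositum; injective by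
  the degree count);
* `FinSubextCat.compositumFunctor : FinSubextCat K₁ K̃₁ ⥤ FinSubextCat K₂ K̃₂` — on a morphism
  `Spec L₁ → Spec M₁`, i.e. a `K₁`-algebra map `σ : M₁ → L₁`, the `K₂`-algebra map `M₁ · K₂ → L₁ · K₂`
  transported from `id ⊗ σ` through the two isomorphisms; `compositumFunctor_map_algebraMap` — it extends
  `σ` along `ι`.
With abc-iut-w5-d048's `GeometricFrobenioidThm62iFunctor.lean` (the functor `Ψ : C₁ → C₂` over ANY base
functor `βψ`, for every pull-back datum) this supplies THE `βψ` of the printed proof; the scheme-theoretic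
hypothesis (a) (how primes and divisors pull back) remains the interface's DATA. Mathlib + the tree's
`FinSubextCat`; nothing here bears on [IUTchIII] or abc.
-/

noncomputable section

open scoped TensorProduct

namespace Literature.AlgebraicGeometry.Frobenioids

namespace FinSubextCat

open CategoryTheory IntermediateField

universe u

variable {K₁ Kt₁ K₂ Kt₂ : Type u} [Field K₁] [Field Kt₁] [Field K₂] [Field Kt₂]
  [Algebra K₁ Kt₁] [Algebra K₂ Kt₂] [Algebra K₁ K₂] [Algebra K₁ Kt₂]
  [IsScalarTower K₁ K₂ Kt₂] [Algebra.IsSeparable K₁ Kt₁]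
  (ι : Kt₁ →ₐ[K₁] Kt₂)
  (hsc : ∀ z : K₂, IsSeparable K₁ z → z ∈ Set.range (algebraMap K₁ K₂))

/-! ### Objects: `L₁ ↦ L₁ · K₂`, of the same degree -/

/-- The image `ι(L₁) ⊆ K̃₂` of a finite subextension `L₁ ⊆ K̃₁`, as an intermediate field of `K̃₂/K₁`
(hypothesis (b): `K̃₁ → K̃₂` over `K₁`). [cite: MochizukiFrdI2008, Thm. 6.2 (i) p.111] -/
def imageField (X : FinSubextCat K₁ Kt₁) : IntermediateField K₁ Kt₂ := X.L.map ι

omit [Algebra K₂ Kt₂] [Algebra K₁ K₂] [IsScalarTower K₁ K₂ Kt₂] [Algebra.IsSeparable K₁ Kt₁] in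
/-- `ι(L₁)` is finite over `K₁` (isomorphic to `L₁`). [cite: MochizukiFrdI2008, Thm. 6.2 (i) p.111] -/
theorem imageField_finiteDimensional (X : FinSubextCat K₁ Kt₁) :
    FiniteDimensional K₁ (imageField ι X) :=
  LinearEquiv.finiteDimensional (X.L.equivMap ι).toLinearEquiv

omit [Algebra K₂ Kt₂] [Algebra K₁ K₂] [IsScalarTower K₁ K₂ Kt₂] in
/-- `ι(L₁)` is separable over `K₁` (as `K̃₁/K₁` is). [cite: MochizukiFrdI2008, Thm. 6.2 (i) p.111] -/
theorem imageField_isSeparable (X : FinSubextCat K₁ Kt₁) :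
    Algebra.IsSeparable K₁ (imageField ι X) := by
  unfold imageField
  exact Algebra.IsSeparable.of_algHom (F := K₁) (E' := ↥X.L) (f := ((X.L.equivMap ι).symm : _ →ₐ[K₁] ↥X.L))

omit [Algebra K₂ Kt₂] [Algebra K₁ K₂] [IsScalarTower K₁ K₂ Kt₂] [Algebra.IsSeparable K₁ Kt₁] in
/-- `[ι(L₁) : K₁] = [L₁ : K₁]`. [cite: MochizukiFrdI2008, Thm. 6.2 (i) p.111] -/
theorem finrank_imageField (X : FinSubextCat K₁ Kt₁) :
    Module.finrank K₁ (imageField ι X) = Module.finrank K₁ X.L :=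
  (LinearEquiv.finrank_eq (X.L.equivMap ι).toLinearEquiv).symm

variable (K₂) in
/-- **`L₂ := L₁ · K₂ ⊆ K̃₂`**, the compositum `K₂(ι L₁)` (p. 111 l. 26). [cite: MochizukiFrdI2008, Thm. 6.2 (i) p.111] -/
def compositumField (X : FinSubextCat K₁ Kt₁) : IntermediateField K₂ Kt₂ :=
  IntermediateField.adjoin K₂ ((imageField ι X : IntermediateField K₁ Kt₂) : Set Kt₂)

include hsc in
/-- **"`[L₂ : K₂] = [L₁ : K₁]`"** (p. 111 l. 27–28) — by the classical linear-disjointness lemma for a separably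
closed base (`Literature.FieldTheory.Regular.finrank_adjoin_eq_of_isSepClosedIn`). [cite: MochizukiFrdI2008, Thm. 6.2 (i) p.111] -/
theorem finrank_compositumField (X : FinSubextCat K₁ Kt₁) :
    Module.finrank K₂ (compositumField K₂ ι X) = Module.finrank K₁ X.L := by
  haveI := imageField_finiteDimensional ι X
  haveI := imageField_isSeparable ι X
  unfold compositumField
  rw [Literature.FieldTheory.Regular.finrank_adjoin_eq_of_isSepClosedIn hsc, finrank_imageField]

include hsc in
/-- `L₁ · K₂` is finite over `K₂`. [cite: MochizukiFrdI2008, Thm. 6.2 (i) p.111] -/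
theorem finiteDimensional_compositumField (X : FinSubextCat K₁ Kt₁) :
    FiniteDimensional K₂ (compositumField K₂ ι X) :=
  Module.finite_of_finrank_pos (by rw [finrank_compositumField ι hsc]; exact Module.finrank_pos)

/-- **The object map of the base functor**: `Spec L₁ ↦ Spec (L₁ · K₂)` (p. 111 l. 26–28).
[cite: MochizukiFrdI2008, Thm. 6.2 (i) p.111] -/
def compositumObj (X : FinSubextCat K₁ Kt₁) : FinSubextCat K₂ Kt₂ :=
  @FinSubextCat.mk K₂ _ Kt₂ _ _ (compositumField K₂ ι X) (finiteDimensional_compositumField ι hsc X)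

/-- The field of `compositumObj X` is the compositum `K₂(ι L₁)`. [cite: MochizukiFrdI2008, Thm. 6.2 (i) p.111] -/
@[simp] theorem compositumObj_L (X : FinSubextCat K₁ Kt₁) : (compositumObj ι hsc X).L = compositumField K₂ ι X := rfl

/-! ### Linear disjointness made explicit: `K₂ ⊗_{K₁} L₁ ≅ L₁ · K₂` -/

variable (K₂) in
omit [Algebra.IsSeparable K₁ Kt₁] in
/-- The multiplication map `K₂ ⊗_{K₁} L₁ → K̃₂`, `k ⊗ y ↦ k · ι(y)` (a `K₂`-algebra homomorphism).
[cite: MochizukiFrdI2008, Thm. 6.2 (i) p.111] -/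
def mulMap (X : FinSubextCat K₁ Kt₁) : K₂ ⊗[K₁] X.L →ₐ[K₂] Kt₂ :=
  Algebra.TensorProduct.lift (Algebra.ofId K₂ Kt₂) (ι.comp X.L.val) (fun _ _ => Commute.all _ _)

omit [Algebra.IsSeparable K₁ Kt₁] in
/-- `mulMap (k ⊗ y) = k · ι y`. [cite: MochizukiFrdI2008, Thm. 6.2 (i) p.111] -/
@[simp] theorem mulMap_tmul (X : FinSubextCat K₁ Kt₁) (k : K₂) (y : X.L) :
    mulMap K₂ ι X (k ⊗ₜ y) = algebraMap K₂ Kt₂ k * ι y := by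
  simp [mulMap, Algebra.ofId_apply]

omit [Algebra.IsSeparable K₁ Kt₁] in
/-- The multiplication map lands in the compositum `K₂(ι L₁)`. [cite: MochizukiFrdI2008, Thm. 6.2 (i) p.111] -/
theorem mulMap_mem (X : FinSubextCat K₁ Kt₁) (t : K₂ ⊗[K₁] X.L) : mulMap K₂ ι X t ∈ compositumField K₂ ι X := by
  induction t using TensorProduct.induction_on with
  | zero => rw [map_zero]; exact zero_mem _
  | tmul k y =>
    rw [mulMap_tmul]
    refine mul_mem (IntermediateField.algebraMap_mem (compositumField K₂ ι X) k) ?_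
    exact IntermediateField.subset_adjoin K₂ _ ⟨y, y.2, rfl⟩
  | add s t hs ht => rw [map_add]; exact add_mem hs ht

variable (K₂) in
omit [Algebra.IsSeparable K₁ Kt₁] in
/-- The multiplication map co-restricted to the compositum. [cite: MochizukiFrdI2008, Thm. 6.2 (i) p.111] -/
def mulMapRestrict (X : FinSubextCat K₁ Kt₁) : K₂ ⊗[K₁] X.L →ₐ[K₂] compositumField K₂ ι X :=
  (mulMap K₂ ι X).codRestrict (compositumField K₂ ι X).toSubalgebra (mulMap_mem ι X)

omit [Algebra.IsSeparable K₁ Kt₁] in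
/-- `↑(mulMapRestrict t) = mulMap t`. [cite: MochizukiFrdI2008, Thm. 6.2 (i) p.111] -/
@[simp] theorem coe_mulMapRestrict (X : FinSubextCat K₁ Kt₁) (t : K₂ ⊗[K₁] X.L) :
    ((mulMapRestrict K₂ ι X t : compositumField K₂ ι X) : Kt₂) = mulMap K₂ ι X t := rfl

/-- The co-restricted multiplication map is SURJECTIVE onto the compositum: `K₂(ι L₁)` is the
`K₂`-subalgebra generated by `ι L₁` (its elements are algebraic), which lies in the range.
[cite: MochizukiFrdI2008, Thm. 6.2 (i) p.111] -/
theorem mulMapRestrict_surjective (X : FinSubextCat K₁ Kt₁) : Function.Surjective (mulMapRestrict K₂ ι X) := by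
  intro z
  have halg : ∀ x ∈ ((imageField ι X : IntermediateField K₁ Kt₂) : Set Kt₂), IsAlgebraic K₂ x := by
    rintro _ ⟨y, hy, rfl⟩
    have hint : IsIntegral K₁ (y : Kt₁) :=
      (Algebra.IsSeparable.isSeparable K₁ (y : Kt₁)).isIntegral
    exact ((hint.map ι).tower_top (A := K₂)).isAlgebraic
  have hz : (z : Kt₂) ∈ (compositumField K₂ ι X).toSubalgebra := z.2
  unfold compositumField at hz
  rw [IntermediateField.adjoin_toSubalgebra_of_isAlgebraic halg] at hz
  have hrange : Algebra.adjoin K₂ ((imageField ι X : IntermediateField K₁ Kt₂) : Set Kt₂) ≤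
      (mulMap K₂ ι X).range := by
    rw [Algebra.adjoin_le_iff]
    rintro _ ⟨y, hy, rfl⟩
    refine ⟨(1 : K₂) ⊗ₜ (⟨y, hy⟩ : X.L), ?_⟩
    change mulMap K₂ ι X ((1 : K₂) ⊗ₜ (⟨y, hy⟩ : X.L)) = ι y
    rw [mulMap_tmul, map_one, one_mul]
  obtain ⟨t, ht⟩ := hrange hz
  exact ⟨t, Subtype.ext ht⟩

include hsc in
/-- … and INJECTIVE, by the degree count `dim_{K₂}(K₂ ⊗_{K₁} L₁) = [L₁ : K₁] = [L₁ · K₂ : K₂]` — this is the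
linear disjointness of `L₁` and `K₂` over `K₁` asserted by the printed "`[L₂ : K₂] = [L₁ : K₁]`".
[cite: MochizukiFrdI2008, Thm. 6.2 (i) p.111] -/
theorem mulMapRestrict_bijective (X : FinSubextCat K₁ Kt₁) : Function.Bijective (mulMapRestrict K₂ ι X) := by
  haveI := finiteDimensional_compositumField ι hsc X
  have hdim : Module.finrank K₂ (K₂ ⊗[K₁] X.L) = Module.finrank K₂ (compositumField K₂ ι X) := by
    rw [Module.finrank_baseChange, finrank_compositumField ι hsc]
  refine ⟨?_, mulMapRestrict_surjective ι X⟩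
  exact ((mulMapRestrict K₂ ι X).toLinearMap.injective_iff_surjective_of_finrank_eq_finrank hdim).2
    (mulMapRestrict_surjective ι X)

/-- **`K₂ ⊗_{K₁} L₁ ≃ L₁ · K₂`** as `K₂`-algebras. [cite: MochizukiFrdI2008, Thm. 6.2 (i) p.111] -/
def compositumEquiv (X : FinSubextCat K₁ Kt₁) : K₂ ⊗[K₁] X.L ≃ₐ[K₂] compositumField K₂ ι X :=
  AlgEquiv.ofBijective (mulMapRestrict K₂ ι X) (mulMapRestrict_bijective ι hsc X)

/-- `compositumEquiv (1 ⊗ y) = ι y`. [cite: MochizukiFrdI2008, Thm. 6.2 (i) p.111] -/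
@[simp] theorem coe_compositumEquiv_one_tmul (X : FinSubextCat K₁ Kt₁) (y : X.L) :
    ((compositumEquiv ι hsc X (1 ⊗ₜ y) : compositumField K₂ ι X) : Kt₂) = ι y := by
  change ((mulMapRestrict K₂ ι X (1 ⊗ₜ y) : compositumField K₂ ι X) : Kt₂) = ι y
  rw [coe_mulMapRestrict, mulMap_tmul, map_one, one_mul]

/-! ### Morphisms and the functor -/

/-- **The base functor on morphisms**: a `K₁`-algebra map `σ : M₁ → L₁` (a morphism `Spec L₁ → Spec M₁` of
`D₁`) induces the `K₂`-algebra map `M₁ · K₂ → L₁ · K₂`, namely `id_{K₂} ⊗ σ` transported through the two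
isomorphisms `compositumEquiv`. [cite: MochizukiFrdI2008, Thm. 6.2 (i) p.111] -/
def compositumMap {X Y : FinSubextCat K₁ Kt₁} (σ : Y.L →ₐ[K₁] X.L) :
    compositumField K₂ ι Y →ₐ[K₂] compositumField K₂ ι X :=
  ((compositumEquiv ι hsc X).toAlgHom.comp (Algebra.TensorProduct.map (AlgHom.id K₂ K₂) σ)).comp
    (compositumEquiv ι hsc Y).symm.toAlgHom

/-- The induced map EXTENDS `σ` along `ι`: `βψ(σ)(ι y) = ι(σ y)` for `y ∈ M₁`.
[cite: MochizukiFrdI2008, Thm. 6.2 (i) p.111] -/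
theorem coe_compositumMap_apply {X Y : FinSubextCat K₁ Kt₁} (σ : Y.L →ₐ[K₁] X.L) (y : Y.L) :
    ((compositumMap ι hsc σ (compositumEquiv ι hsc Y (1 ⊗ₜ y)) : compositumField K₂ ι X) : Kt₂) = ι (σ y) := by
  change ((compositumEquiv ι hsc X (Algebra.TensorProduct.map (AlgHom.id K₂ K₂) σ
      ((compositumEquiv ι hsc Y).symm (compositumEquiv ι hsc Y (1 ⊗ₜ y)))) : compositumField K₂ ι X) : Kt₂) =
    ι (σ y)
  rw [AlgEquiv.symm_apply_apply, Algebra.TensorProduct.map_tmul, AlgHom.id_apply]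
  exact coe_compositumEquiv_one_tmul ι hsc X (σ y)

/-- Functoriality: identities. [cite: MochizukiFrdI2008, Thm. 6.2 (i) p.111] -/
theorem compositumMap_id (X : FinSubextCat K₁ Kt₁) :
    compositumMap ι hsc (AlgHom.id K₁ X.L) = AlgHom.id K₂ (compositumField K₂ ι X) := by
  apply AlgHom.ext
  intro z
  change compositumEquiv ι hsc X (Algebra.TensorProduct.map (AlgHom.id K₂ K₂) (AlgHom.id K₁ X.L)
      ((compositumEquiv ι hsc X).symm z)) = z
  rw [Algebra.TensorProduct.map_id, AlgHom.id_apply, AlgEquiv.apply_symm_apply]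

/-- Functoriality: composition (`D₁`'s composition of `Spec L → Spec M → Spec N` is `τ ∘ σ` on fields).
[cite: MochizukiFrdI2008, Thm. 6.2 (i) p.111] -/
theorem compositumMap_comp {X Y Z : FinSubextCat K₁ Kt₁} (σ : Y.L →ₐ[K₁] X.L) (τ : Z.L →ₐ[K₁] Y.L) :
    compositumMap ι hsc (σ.comp τ) = (compositumMap ι hsc σ).comp (compositumMap ι hsc τ) := by
  apply AlgHom.ext
  intro z
  change compositumEquiv ι hsc X (Algebra.TensorProduct.map (AlgHom.id K₂ K₂) (σ.comp τ)
      ((compositumEquiv ι hsc Z).symm z)) =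
    compositumEquiv ι hsc X (Algebra.TensorProduct.map (AlgHom.id K₂ K₂) σ
      ((compositumEquiv ι hsc Y).symm (compositumEquiv ι hsc Y
        (Algebra.TensorProduct.map (AlgHom.id K₂ K₂) τ ((compositumEquiv ι hsc Z).symm z)))))
  rw [AlgEquiv.symm_apply_apply, Algebra.TensorProduct.map_id_comp, AlgHom.comp_apply]

/-- **"Thus, `ψ` determines a functor `D₁ → D₂`"** (p. 111 l. 28): the base functor
`FinSubextCat K₁ K̃₁ ⥤ FinSubextCat K₂ K̃₂`, `Spec L₁ ↦ Spec (L₁ · K₂)`, induced by `K₁ ↪ K₂` under hypotheses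
(b) (`ι : K̃₁ → K̃₂` over `K₁ → K₂ → K̃₂`) and (c) (`K₁` separably closed in `K₂`).
[cite: MochizukiFrdI2008, Thm. 6.2 (i) p.111] -/
def compositumFunctor : FinSubextCat K₁ Kt₁ ⥤ FinSubextCat K₂ Kt₂ where
  obj X := compositumObj ι hsc X
  map f := ⟨compositumMap ι hsc f.toAlgHom⟩
  map_id X := FinSubextCat.hom_ext (compositumMap_id ι hsc X)
  map_comp f g := FinSubextCat.hom_ext (compositumMap_comp ι hsc f.toAlgHom g.toAlgHom)

/-- On objects the base functor is `L₁ ↦ L₁ · K₂`. [cite: MochizukiFrdI2008, Thm. 6.2 (i) p.111] -/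
theorem compositumFunctor_obj_L (X : FinSubextCat K₁ Kt₁) :
    ((compositumFunctor ι hsc).obj X).L = compositumField K₂ ι X := rfl

/-- **Degree preservation** (p. 111 l. 27–28): `[(βψ X).L : K₂] = [X.L : K₁]`.
[cite: MochizukiFrdI2008, Thm. 6.2 (i) p.111] -/
theorem finrank_compositumFunctor_obj (X : FinSubextCat K₁ Kt₁) :
    Module.finrank K₂ ((compositumFunctor ι hsc).obj X).L = Module.finrank K₁ X.L :=
  finrank_compositumField ι hsc X

/-- On morphisms the base functor extends the given field maps along `ι` (compatibility with
"the functor `D₁ → D₂` induced by the inclusion of fields `K₁ ↪ K₂`"). [cite: MochizukiFrdI2008, Thm. 6.2 (i) p.111] -/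
theorem compositumFunctor_map_extends {X Y : FinSubextCat K₁ Kt₁} (f : X ⟶ Y) (y : Y.L) :
    ((((compositumFunctor ι hsc).map f).toAlgHom (compositumEquiv ι hsc Y (1 ⊗ₜ y)) :
      compositumField K₂ ι X) : Kt₂) = ι (f.toAlgHom y) :=
  coe_compositumMap_apply ι hsc f.toAlgHom y

end FinSubextCat

end Literature.AlgebraicGeometry.Frobenioids

end
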